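import Summits.QuantumFields.YangMills.Theorems.ColdStartUniversalityLatticeLangevinContDep
import Summits.QuantumFields.YangMills.Theorems.ColdStartUniversalityLatticeLangevinWellPosed
import Literature.MathematicalPhysics.QuantumFieldTheory.Balaban1983to89.T4AveragingDisintegration
import HarnessLib

/-!
# Route `ColdStartUniversality` (rung input (M) groundwork, crux K_A1 stmt-QuantumFields-24809): the named fact
# `LatticeLangevinMeasurableFlow (fundamentalLatticeRep 2) 3 L β` (Kunita / SZZ Lemma 3.2) HOLDS —
# a version of the SU(2) lattice Langevin solution family jointly measurable in (start, ω)

Helper file (seat `ym-line-csu-p1`, g4).  Discharge of the tree's named fact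
`Literature.MathematicalPhysics.QuantumFieldTheory.LatticeLangevinMeasurableFlow` for `SU(2)` in its fundamental
representation on `(ℤ/L)³` (cite item wi-87245): on every probability space (in `Type`) with a flat Brownian motion
`W` there is a family `U : SU(2)^E → (ℝ≥0 → Ω → SU(2)^E)` of solutions of the Shen–Zhu–Zhu system from every
start, adapted to the raw natural filtration of `W`, with `(x, ω) ↦ U x t ω` measurable for every `t`.

Proof (a measurable-modification argument replacing Kunita's Kolmogorov-continuity one, which the tree cannot yet
run): take a dense sequence `u` of starts and measurable selectors `ι n` with `Σ_e ‖ρ(u (ι n x) e) − ρ(x e)‖_F² < 4⁻ⁿ`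
(`exists_measurable_nets`); by the quantitative continuous dependence `latticeLangevin_contDep` (seat g3) and
Borel–Cantelli, a.s. the solutions from `u (ι n x)` converge to the solution from `x` at all times simultaneously
(`ae_tendsto_solutions`); the pointwise `limUnder` of these jointly measurable approximants is the measurable
version (`MeasureTheory.StronglyMeasurable.limUnder`), indistinguishable from the solution from `x`, hence itself
a solution (`isSolution_of_indist`).

This is the Markov-property ingredient of the semigroup route (Doob / Krylov–Bogoliubov) to the rung's single open
input (M) «pointwise mixing of the cold-start law», and it closes the hypothesis of
`TransportPerturbation.solutionFamily_of_measurableFlow` (item stmt-QuantumFields-26920).  No definition, no sorry.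
RECORD-rung R3 plumbing; nothing here bears on the Yang–Mills mass gap.
-/

set_option autoImplicit false

noncomputable section

namespace Summit.QuantumFields.YangMills.Theorems.ColdStartUniversality

open MeasureTheory ProbabilityTheory Filter Topology
open scoped NNReal ENNReal BigOperators
open Literature.Probability.Process Literature.MathematicalPhysics.QuantumFieldTheory
open Literature.MathematicalPhysics.QuantumLattice (fundamentalRep fundamentalLatticeRep continuous_fundamentalRep)

/-! ## Indistinguishable versions of solutions -/

section Indist

variable {Ω : Type*} {mΩ : MeasurableSpace Ω} {P : Measure Ω} {𝓕 : Filtration ℝ≥0 mΩ}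
  {d L N : ℕ} {κ : Type*} [Fintype κ] {G : Type*} [Group G] [TopologicalSpace G] [MeasurableSpace G]

/-- **An adapted process indistinguishable from a solution of a link SDE is a solution** (same Itô integrals;
the integrands change on a null set of paths only, `isItoIntegralC_congr_ae`). [folklore] -/
theorem isSolution_of_indist (S : LinkSDE d L N κ) (ρ : G →* Matrix (Fin N) (Fin N) ℂ)
    (W : ℝ≥0 → Ω → (Edge d L × κ → ℝ)) {U U' : ℝ≥0 → Ω → GaugeConfig d L G}
    (hU : S.IsSolution ρ 𝓕 P W U) (had : ∀ t, Measurable[𝓕 t] (U' t))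
    (h : ∀ᵐ ω ∂P, ∀ t, U' t ω = U t ω) : S.IsSolution ρ 𝓕 P W U' := by
  refine ⟨had, ?_, ?_⟩
  · filter_upwards [hU.continuous, h] with ω hc hω
    have hfun : (fun t => U' t ω) = fun t => U t ω := funext hω
    rw [hfun]
    exact hc
  · obtain ⟨J, hJ, hEq⟩ := hU.exists_ito
    refine ⟨J, fun e n i j => isItoIntegralC_congr_ae (h.mono fun ω hω t => by rw [hω t]) (hJ e n i j), ?_⟩
    filter_upwards [hEq, h] with ω hω hω'
    intro t e i j
    simp only [hω']
    exact hω t e i j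

end Indist

/-! ## The configuration space `SU(2)^E`: a continuous separating «distance», convergence, measurable nets -/

section Config

variable {L : ℕ} [NeZero L]

/-- `‖X i j‖² ≤ ⟨X, X⟩_{HS}`. [folklore] -/
theorem norm_entry_sq_le_hsForm {N : ℕ} (X : Matrix (Fin N) (Fin N) ℂ) (i j : Fin N) :
    ‖X i j‖ ^ 2 ≤ hsForm N X X := by
  rw [hsForm_self]
  calc ‖X i j‖ ^ 2 ≤ ∑ j', ‖X i j'‖ ^ 2 :=
        Finset.single_le_sum (f := fun j' => ‖X i j'‖ ^ 2) (fun _ _ => by positivity) (Finset.mem_univ j)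
    _ ≤ ∑ i', ∑ j', ‖X i' j'‖ ^ 2 :=
        Finset.single_le_sum (f := fun i' => ∑ j', ‖X i' j'‖ ^ 2) (fun _ _ => by positivity) (Finset.mem_univ i)

/-- The squared Hilbert–Schmidt «distance» `Σ_e ‖ρ(x e) − ρ(y e)‖_F²` on `SU(2)^E` is jointly continuous (stated along two
continuous maps, the form in which it is used). [folklore] -/
theorem continuous_hsDist {X : Type*} [TopologicalSpace X]
    {f g : X → GaugeConfig 3 L (Matrix.specialUnitaryGroup (Fin 2) ℂ)} (hf : Continuous f) (hg : Continuous g) :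
    Continuous fun p : X =>
      ∑ e, hsForm 2 ((fundamentalRep (Fin 2) (f p e) : Matrix (Fin 2) (Fin 2) ℂ) - fundamentalRep (Fin 2) (g p e))
        ((fundamentalRep (Fin 2) (f p e) : Matrix (Fin 2) (Fin 2) ℂ) - fundamentalRep (Fin 2) (g p e)) := by
  refine continuous_finsetSum _ fun e _ => ?_
  have hM : Continuous fun p : X =>
      (fundamentalRep (Fin 2) (f p e) : Matrix (Fin 2) (Fin 2) ℂ) - fundamentalRep (Fin 2) (g p e) :=
    ((continuous_fundamentalRep _).comp ((continuous_apply e).comp hf)).sub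
      ((continuous_fundamentalRep _).comp ((continuous_apply e).comp hg))
  simp only [hsForm_apply]
  exact Complex.continuous_re.comp ((hM.matrix_mul hM.matrix_conjTranspose).matrix_trace)

/-- The «distance» vanishes on the diagonal. [folklore] -/
theorem hsDist_self (x : GaugeConfig 3 L (Matrix.specialUnitaryGroup (Fin 2) ℂ)) :
    ∑ e, hsForm 2 ((fundamentalRep (Fin 2) (x e) : Matrix (Fin 2) (Fin 2) ℂ) - fundamentalRep (Fin 2) (x e))
        ((fundamentalRep (Fin 2) (x e) : Matrix (Fin 2) (Fin 2) ℂ) - fundamentalRep (Fin 2) (x e)) = 0 := by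
  simp

/-- The «distance» is nonnegative. [folklore] -/
theorem hsDist_nonneg (x y : GaugeConfig 3 L (Matrix.specialUnitaryGroup (Fin 2) ℂ)) :
    0 ≤ ∑ e, hsForm 2 ((fundamentalRep (Fin 2) (x e) : Matrix (Fin 2) (Fin 2) ℂ) - fundamentalRep (Fin 2) (y e))
        ((fundamentalRep (Fin 2) (x e) : Matrix (Fin 2) (Fin 2) ℂ) - fundamentalRep (Fin 2) (y e)) :=
  Finset.sum_nonneg fun _ _ => hsForm_self_nonneg _

/-- **Convergence criterion**: if `Σ_e ‖ρ(yₙ e) − ρ(z e)‖_F² → 0` then `yₙ → z` in `SU(2)^E` (the topology of `SU(2)` is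
induced by the matrix entries). [folklore] -/
theorem tendsto_of_hsDist_tendsto_zero {y : ℕ → GaugeConfig 3 L (Matrix.specialUnitaryGroup (Fin 2) ℂ)}
    {z : GaugeConfig 3 L (Matrix.specialUnitaryGroup (Fin 2) ℂ)}
    (h : Tendsto (fun n => ∑ e,
        hsForm 2 ((fundamentalRep (Fin 2) (y n e) : Matrix (Fin 2) (Fin 2) ℂ) - fundamentalRep (Fin 2) (z e))
          ((fundamentalRep (Fin 2) (y n e) : Matrix (Fin 2) (Fin 2) ℂ) - fundamentalRep (Fin 2) (z e))) atTop (𝓝 0)) :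
    Tendsto y atTop (𝓝 z) := by
  refine tendsto_pi_nhds.2 fun e => ?_
  rw [tendsto_subtype_rng]
  -- entrywise convergence of the matrices
  refine tendsto_pi_nhds.2 fun i => tendsto_pi_nhds.2 fun j => ?_
  rw [tendsto_iff_norm_sub_tendsto_zero]
  have hsq : Tendsto (fun n => ‖((y n e : Matrix (Fin 2) (Fin 2) ℂ) - (z e : Matrix (Fin 2) (Fin 2) ℂ)) i j‖ ^ 2)
      atTop (𝓝 0) := by
    refine squeeze_zero (fun n => by positivity) (fun n => ?_) h
    calc ‖((y n e : Matrix (Fin 2) (Fin 2) ℂ) - (z e : Matrix (Fin 2) (Fin 2) ℂ)) i j‖ ^ 2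
        ≤ hsForm 2 ((y n e : Matrix (Fin 2) (Fin 2) ℂ) - z e) ((y n e : Matrix (Fin 2) (Fin 2) ℂ) - z e) :=
          norm_entry_sq_le_hsForm _ i j
      _ ≤ ∑ e', hsForm 2 ((fundamentalRep (Fin 2) (y n e') : Matrix (Fin 2) (Fin 2) ℂ) - fundamentalRep (Fin 2) (z e'))
          ((fundamentalRep (Fin 2) (y n e') : Matrix (Fin 2) (Fin 2) ℂ) - fundamentalRep (Fin 2) (z e')) :=
          Finset.single_le_sum (f := fun e' => hsForm 2
            ((fundamentalRep (Fin 2) (y n e') : Matrix (Fin 2) (Fin 2) ℂ) - fundamentalRep (Fin 2) (z e'))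
            ((fundamentalRep (Fin 2) (y n e') : Matrix (Fin 2) (Fin 2) ℂ) - fundamentalRep (Fin 2) (z e')))
            (fun _ _ => hsForm_self_nonneg _) (Finset.mem_univ e)
  have hsqrt := (Real.continuous_sqrt.tendsto 0).comp hsq
  rw [Real.sqrt_zero] at hsqrt
  refine hsqrt.congr fun n => ?_
  simp only [Function.comp_apply, Real.sqrt_sq (norm_nonneg _), Matrix.sub_apply]

/-- `M₂(ℂ)`, `SU(2)` and `SU(2)^E` are second countable (the `Matrix` synonym hides the `Pi` instance). [folklore] -/
theorem secondCountableTopology_su2 : SecondCountableTopology (Matrix.specialUnitaryGroup (Fin 2) ℂ) := by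
  haveI : SecondCountableTopology (Matrix (Fin 2) (Fin 2) ℂ) :=
    inferInstanceAs (SecondCountableTopology (Fin 2 → Fin 2 → ℂ))
  infer_instance

/-- `SU(2)^E` is a Polish space (closed subset of matrices, finite product). [folklore] -/
theorem polishSpace_config (L : ℕ) [NeZero L] : PolishSpace (GaugeConfig 3 L (Matrix.specialUnitaryGroup (Fin 2) ℂ)) := by
  haveI : PolishSpace (Matrix.specialUnitaryGroup (Fin 2) ℂ) :=
    Balaban1983to89.T4AveragingDisintegration.polishSpace_specialUnitaryGroup
  infer_instance

/-- The product σ-algebra on `SU(2)^E` is the Borel σ-algebra of the product topology. [folklore] -/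
theorem borelSpace_config (L : ℕ) [NeZero L] : BorelSpace (GaugeConfig 3 L (Matrix.specialUnitaryGroup (Fin 2) ℂ)) := by
  haveI := secondCountableTopology_su2
  infer_instance

/-- **Measurable `4⁻ⁿ`-nets of starts**: a sequence `u` of configurations and measurable selectors `ι n` with
`Σ_e ‖ρ(u (ι n x) e) − ρ(x e)‖_F² < 4⁻ⁿ` for all `x` (a dense sequence of the compact metrisable `SU(2)^E` and
`Nat.find`). [folklore] -/
theorem exists_measurable_nets (L : ℕ) [NeZero L] :
    ∃ (u : ℕ → GaugeConfig 3 L (Matrix.specialUnitaryGroup (Fin 2) ℂ))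
      (ι : ℕ → GaugeConfig 3 L (Matrix.specialUnitaryGroup (Fin 2) ℂ) → ℕ),
      (∀ n, Measurable (ι n)) ∧
      ∀ n x, ∑ e, hsForm 2 ((fundamentalRep (Fin 2) (u (ι n x) e) : Matrix (Fin 2) (Fin 2) ℂ) - fundamentalRep (Fin 2) (x e))
          ((fundamentalRep (Fin 2) (u (ι n x) e) : Matrix (Fin 2) (Fin 2) ℂ) - fundamentalRep (Fin 2) (x e)) <
        ((1 : ℝ) / 4) ^ n := by
  classical
  haveI := secondCountableTopology_su2
  haveI : Nonempty (GaugeConfig 3 L (Matrix.specialUnitaryGroup (Fin 2) ℂ)) := ⟨fun _ => 1⟩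
  obtain ⟨u, hu⟩ := TopologicalSpace.exists_dense_seq (GaugeConfig 3 L (Matrix.specialUnitaryGroup (Fin 2) ℂ))
  -- the «distance» to a fixed sequence point is continuous
  have hcont : ∀ k, Continuous fun x : GaugeConfig 3 L (Matrix.specialUnitaryGroup (Fin 2) ℂ) =>
      ∑ e, hsForm 2 ((fundamentalRep (Fin 2) (u k e) : Matrix (Fin 2) (Fin 2) ℂ) - fundamentalRep (Fin 2) (x e))
        ((fundamentalRep (Fin 2) (u k e) : Matrix (Fin 2) (Fin 2) ℂ) - fundamentalRep (Fin 2) (x e)) := fun k =>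
    continuous_hsDist continuous_const continuous_id'
  have hex : ∀ (n : ℕ) (x : GaugeConfig 3 L (Matrix.specialUnitaryGroup (Fin 2) ℂ)), ∃ k,
      ∑ e, hsForm 2 ((fundamentalRep (Fin 2) (u k e) : Matrix (Fin 2) (Fin 2) ℂ) - fundamentalRep (Fin 2) (x e))
        ((fundamentalRep (Fin 2) (u k e) : Matrix (Fin 2) (Fin 2) ℂ) - fundamentalRep (Fin 2) (x e)) <
        ((1 : ℝ) / 4) ^ n := by
    intro n x
    have hopen : IsOpen {y : GaugeConfig 3 L (Matrix.specialUnitaryGroup (Fin 2) ℂ) |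
        ∑ e, hsForm 2 ((fundamentalRep (Fin 2) (y e) : Matrix (Fin 2) (Fin 2) ℂ) - fundamentalRep (Fin 2) (x e))
          ((fundamentalRep (Fin 2) (y e) : Matrix (Fin 2) (Fin 2) ℂ) - fundamentalRep (Fin 2) (x e)) <
          ((1 : ℝ) / 4) ^ n} :=
      isOpen_lt (continuous_hsDist continuous_id' continuous_const) continuous_const
    have hmem : {y : GaugeConfig 3 L (Matrix.specialUnitaryGroup (Fin 2) ℂ) |
        ∑ e, hsForm 2 ((fundamentalRep (Fin 2) (y e) : Matrix (Fin 2) (Fin 2) ℂ) - fundamentalRep (Fin 2) (x e))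
          ((fundamentalRep (Fin 2) (y e) : Matrix (Fin 2) (Fin 2) ℂ) - fundamentalRep (Fin 2) (x e)) <
          ((1 : ℝ) / 4) ^ n} ∈ 𝓝 x :=
      hopen.mem_nhds (by rw [Set.mem_setOf_eq, hsDist_self]; positivity)
    exact hu.mem_nhds hmem
  refine ⟨u, fun n x => Nat.find (hex n x), fun n => ?_, fun n x => Nat.find_spec (hex n x)⟩
  exact measurable_find (fun x => hex n x) fun k => (isOpen_lt (hcont k) continuous_const).measurableSet

end Config

/-! ## Almost sure convergence at all times from summable sup-moment bounds (Borel–Cantelli) -/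

section Convergence

variable {Ω : Type*} {mΩ : MeasurableSpace Ω} {P : Measure Ω}

/-- **Borel–Cantelli along a dense time sequence.**  Processes `V n`, `U` with a.s. continuous paths in a space `E`
with a continuous nonnegative «distance» `D` detecting convergence, such that for every horizon `T` the sup over
`[0, T]` of `D(V n, U)` has first moment `≤ 4⁻ⁿ · B_T` (`B_T < ∞`): then a.s. `V n t → U t` for ALL `t` simultaneously.
(Markov at level `2⁻ⁿ` on the countable sup over a dense time sequence, Borel–Cantelli, path continuity.) [folklore] -/
theorem ae_tendsto_of_iSup_bounds [IsFiniteMeasure P] {E : Type*} [TopologicalSpace E] {D : E → E → ℝ}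
    (hD : Continuous fun p : E × E => D p.1 p.2) (hD0 : ∀ a b, 0 ≤ D a b)
    (hDt : ∀ (y : ℕ → E) (z : E), Tendsto (fun n => D (y n) z) atTop (𝓝 0) → Tendsto y atTop (𝓝 z))
    {U : ℝ≥0 → Ω → E} {V : ℕ → ℝ≥0 → Ω → E}
    (hmeas : ∀ n s, Measurable fun ω => D (V n s ω) (U s ω))
    (hB : ∀ T : ℝ≥0, ∃ B : ℝ≥0∞, B ≠ ∞ ∧ ∀ n,
      ∫⁻ ω, ⨆ s ∈ Set.Iic T, ENNReal.ofReal (D (V n s ω) (U s ω)) ∂P ≤ ENNReal.ofReal (((1 : ℝ) / 4) ^ n) * B)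
    (hUc : ∀ᵐ ω ∂P, Continuous fun t => U t ω) (hVc : ∀ n, ∀ᵐ ω ∂P, Continuous fun t => V n t ω) :
    ∀ᵐ ω ∂P, ∀ t, Tendsto (fun n => V n t ω) atTop (𝓝 (U t ω)) := by
  classical
  obtain ⟨τ, hτ⟩ := TopologicalSpace.exists_dense_seq ℝ≥0
  -- Step 1: for each horizon, a.s. eventually all sequence-time «distances» up to the horizon are `< 2⁻ⁿ`
  have step : ∀ m : ℕ, ∀ᵐ ω ∂P, ∀ᶠ n in atTop, ∀ j, τ j ≤ (m + 1 : ℝ≥0) →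
      D (V n (τ j) ω) (U (τ j) ω) < ((1 : ℝ) / 2) ^ n := by
    intro m
    obtain ⟨B, hBtop, hB⟩ := hB (m + 1 : ℝ≥0)
    set f : ℕ → Ω → ℝ≥0∞ := fun n ω => ⨆ j : {j : ℕ // τ j ≤ (m + 1 : ℝ≥0)},
      ENNReal.ofReal (D (V n (τ j) ω) (U (τ j) ω)) with hf
    have hfm : ∀ n, Measurable (f n) := fun n =>
      Measurable.iSup fun j => (hmeas n (τ j)).ennreal_ofReal
    have hfle : ∀ n ω, f n ω ≤ ⨆ s ∈ Set.Iic (m + 1 : ℝ≥0), ENNReal.ofReal (D (V n s ω) (U s ω)) := fun n ω =>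
      iSup_le fun j => le_iSup₂_of_le (f := fun s (_ : s ∈ Set.Iic (m + 1 : ℝ≥0)) =>
        ENNReal.ofReal (D (V n s ω) (U s ω))) (τ j) j.2 le_rfl
    have h4 : ∀ n : ℕ, ENNReal.ofReal (((1 : ℝ) / 4) ^ n) =
        ENNReal.ofReal (((1 : ℝ) / 2) ^ n) * ENNReal.ofReal (((1 : ℝ) / 2) ^ n) := fun n => by
      rw [← ENNReal.ofReal_mul (by positivity), ← mul_pow]
      norm_num
    have hne0 : ∀ n : ℕ, ENNReal.ofReal (((1 : ℝ) / 2) ^ n) ≠ 0 := fun n =>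
      (ENNReal.ofReal_pos.2 (by positivity)).ne'
    -- Markov at level `2⁻ⁿ`
    have hmk : ∀ n, P {ω | ENNReal.ofReal (((1 : ℝ) / 2) ^ n) ≤ f n ω} ≤ ENNReal.ofReal (((1 : ℝ) / 2) ^ n) * B := by
      intro n
      have h1 := mul_meas_ge_le_lintegral₀ (μ := P) (hfm n).aemeasurable (ENNReal.ofReal (((1 : ℝ) / 2) ^ n))
      have h2 : ∫⁻ ω, f n ω ∂P ≤ ENNReal.ofReal (((1 : ℝ) / 2) ^ n) * (ENNReal.ofReal (((1 : ℝ) / 2) ^ n) * B) := by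
        rw [← mul_assoc, ← h4 n]
        exact (lintegral_mono (hfle n)).trans (hB n)
      exact (ENNReal.mul_le_mul_iff_right (hne0 n) ENNReal.ofReal_ne_top).mp (h1.trans h2)
    -- summability of the Markov bounds
    have hgeom : ∑' n : ℕ, ENNReal.ofReal (((1 : ℝ) / 2) ^ n) * B = 2 * B := by
      rw [ENNReal.tsum_mul_right]
      congr 1
      simp_rw [ENNReal.ofReal_pow (by norm_num : (0 : ℝ) ≤ 1 / 2)]
      rw [ENNReal.tsum_geometric, one_div, ENNReal.ofReal_inv_of_pos (by norm_num : (0 : ℝ) < 2),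
        ENNReal.ofReal_ofNat, ENNReal.one_sub_inv_two, inv_inv]
    have hsum : ∑' n, P {ω | ENNReal.ofReal (((1 : ℝ) / 2) ^ n) ≤ f n ω} ≠ ∞ := by
      refine ne_top_of_le_ne_top ?_ (ENNReal.tsum_le_tsum hmk)
      rw [hgeom]
      exact ENNReal.mul_ne_top (by norm_num) hBtop
    -- Borel–Cantelli
    filter_upwards [MeasureTheory.ae_eventually_notMem hsum] with ω hω
    refine hω.mono fun n hn j hj => ?_
    have hlt : f n ω < ENNReal.ofReal (((1 : ℝ) / 2) ^ n) := not_le.1 hn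
    have hj' : ENNReal.ofReal (D (V n (τ j) ω) (U (τ j) ω)) < ENNReal.ofReal (((1 : ℝ) / 2) ^ n) :=
      lt_of_le_of_lt (le_iSup (fun j : {j : ℕ // τ j ≤ (m + 1 : ℝ≥0)} =>
        ENNReal.ofReal (D (V n (τ j) ω) (U (τ j) ω))) ⟨j, hj⟩) hlt
    exact (ENNReal.ofReal_lt_ofReal_iff (by positivity)).1 hj'
  -- Step 2: all horizons at once, and path continuity
  have hall := ae_all_iff.2 step
  have hVc' := ae_all_iff.2 hVc
  filter_upwards [hall, hUc, hVc'] with ω hω hUω hVω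
  intro t
  apply hDt
  obtain ⟨m, hm⟩ := exists_nat_ge t
  have htm : t < (m + 1 : ℝ≥0) := lt_of_le_of_lt hm (lt_add_one _)
  have hkey : ∀ᶠ n in atTop, D (V n t ω) (U t ω) ≤ ((1 : ℝ) / 2) ^ n := by
    refine (hω m).mono fun n hn => ?_
    have hg' := hD.comp ((hVω n).prodMk hUω)
    have hg : Continuous fun s => D (V n s ω) (U s ω) := hg'
    have hmemc : t ∈ closure (Set.range τ) := by
      rw [hτ.closure_range]
      exact Set.mem_univ t
    obtain ⟨a, ha, hat⟩ := mem_closure_iff_seq_limit.1 hmemc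
    have hev : ∀ᶠ l in atTop, a l < (m + 1 : ℝ≥0) := hat.eventually (eventually_lt_nhds htm)
    have hvals : ∀ᶠ l in atTop, D (V n (a l) ω) (U (a l) ω) ≤ ((1 : ℝ) / 2) ^ n := by
      filter_upwards [hev] with l hl
      obtain ⟨j, hj⟩ := ha l
      rw [← hj] at hl ⊢
      exact (hn j hl.le).le
    exact le_of_tendsto ((hg.tendsto t).comp hat) hvals
  have hhalf : Tendsto (fun n : ℕ => ((1 : ℝ) / 2) ^ n) atTop (𝓝 0) :=
    tendsto_pow_atTop_nhds_zero_of_lt_one (by norm_num) (by norm_num)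
  exact squeeze_zero' (Eventually.of_forall fun n => hD0 _ _) hkey hhalf

/-- **A.s. convergence at all times of SU(2) Langevin solutions from `4⁻ⁿ`-close starts** (same flat driver): the
quantitative continuous dependence `latticeLangevin_contDep` feeds `ae_tendsto_of_iSup_bounds`. [folklore] -/
theorem ae_tendsto_solutions [IsProbabilityMeasure P] {L : ℕ} [NeZero L]
    {W : ℝ≥0 → Ω → (Edge 3 L × NoiseIdx 2 → ℝ)} (hW : IsFlatBrownian W P) (β : ℝ)
    {x : GaugeConfig 3 L (Matrix.specialUnitaryGroup (Fin 2) ℂ)}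
    {xs : ℕ → GaugeConfig 3 L (Matrix.specialUnitaryGroup (Fin 2) ℂ)}
    (hxs : ∀ n, ∑ e, hsForm 2 ((fundamentalRep (Fin 2) (xs n e) : Matrix (Fin 2) (Fin 2) ℂ) - fundamentalRep (Fin 2) (x e))
        ((fundamentalRep (Fin 2) (xs n e) : Matrix (Fin 2) (Fin 2) ℂ) - fundamentalRep (Fin 2) (x e)) ≤ ((1 : ℝ) / 4) ^ n)
    {U : ℝ≥0 → Ω → GaugeConfig 3 L (Matrix.specialUnitaryGroup (Fin 2) ℂ)}
    {V : ℕ → ℝ≥0 → Ω → GaugeConfig 3 L (Matrix.specialUnitaryGroup (Fin 2) ℂ)}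
    (hU0 : ∀ ω, U 0 ω = x)
    (hU : (latticeLangevinDynamics (fundamentalLatticeRep 2) β).IsSolution (fundamentalRep (Fin 2))
      hW.natFiltration P W U)
    (hV0 : ∀ n ω, V n 0 ω = xs n)
    (hV : ∀ n, (latticeLangevinDynamics (fundamentalLatticeRep 2) β).IsSolution (fundamentalRep (Fin 2))
      hW.natFiltration P W (V n)) :
    ∀ᵐ ω ∂P, ∀ t, Tendsto (fun n => V n t ω) atTop (𝓝 (U t ω)) := by
  haveI := secondCountableTopology_su2
  haveI := borelSpace_config L
  refine ae_tendsto_of_iSup_bounds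
    (D := fun a b : GaugeConfig 3 L (Matrix.specialUnitaryGroup (Fin 2) ℂ) =>
      ∑ e, hsForm 2 ((fundamentalRep (Fin 2) (a e) : Matrix (Fin 2) (Fin 2) ℂ) - fundamentalRep (Fin 2) (b e))
        ((fundamentalRep (Fin 2) (a e) : Matrix (Fin 2) (Fin 2) ℂ) - fundamentalRep (Fin 2) (b e)))
    (continuous_hsDist continuous_fst continuous_snd) (fun a b => hsDist_nonneg a b)
    (fun y z h => tendsto_of_hsDist_tendsto_zero h) (fun n s => ?_) (fun T => ?_) hU.continuous
    (fun n => (hV n).continuous)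
  · have hVm : Measurable (V n s) := ((hV n).adapted s).mono (hW.natFiltration.le s) le_rfl
    have hUm : Measurable (U s) := (hU.adapted s).mono (hW.natFiltration.le s) le_rfl
    have hDm : Measurable (fun p : GaugeConfig 3 L (Matrix.specialUnitaryGroup (Fin 2) ℂ) ×
        GaugeConfig 3 L (Matrix.specialUnitaryGroup (Fin 2) ℂ) =>
        ∑ e, hsForm 2 ((fundamentalRep (Fin 2) (p.1 e) : Matrix (Fin 2) (Fin 2) ℂ) - fundamentalRep (Fin 2) (p.2 e))
          ((fundamentalRep (Fin 2) (p.1 e) : Matrix (Fin 2) (Fin 2) ℂ) - fundamentalRep (Fin 2) (p.2 e))) :=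
      (continuous_hsDist continuous_fst continuous_snd).measurable
    have h := hDm.comp (hVm.prodMk hUm)
    exact h
  · obtain ⟨C, hC⟩ := latticeLangevin_contDep L β T
    refine ⟨2 * ENNReal.ofReal (Real.exp (C * T)), ENNReal.mul_ne_top (by norm_num) ENNReal.ofReal_ne_top,
      fun n => ?_⟩
    have h := hC hW (xs n) x (hV0 n) hU0 (hV n) hU T le_rfl
    refine h.trans ?_
    have hmono : ENNReal.ofReal (∑ e,
        hsForm 2 ((fundamentalRep (Fin 2) (xs n e) : Matrix (Fin 2) (Fin 2) ℂ) - fundamentalRep (Fin 2) (x e))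
          ((fundamentalRep (Fin 2) (xs n e) : Matrix (Fin 2) (Fin 2) ℂ) - fundamentalRep (Fin 2) (x e))) ≤
        ENNReal.ofReal (((1 : ℝ) / 4) ^ n) := ENNReal.ofReal_le_ofReal (hxs n)
    calc 2 * ENNReal.ofReal (∑ e,
            hsForm 2 ((fundamentalRep (Fin 2) (xs n e) : Matrix (Fin 2) (Fin 2) ℂ) - fundamentalRep (Fin 2) (x e))
              ((fundamentalRep (Fin 2) (xs n e) : Matrix (Fin 2) (Fin 2) ℂ) - fundamentalRep (Fin 2) (x e))) *
            ENNReal.ofReal (Real.exp (C * T))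
        ≤ 2 * ENNReal.ofReal (((1 : ℝ) / 4) ^ n) * ENNReal.ofReal (Real.exp (C * T)) :=
          mul_le_mul' (mul_le_mul' le_rfl hmono) le_rfl
      _ = ENNReal.ofReal (((1 : ℝ) / 4) ^ n) * (2 * ENNReal.ofReal (Real.exp (C * T))) := by ring

end Convergence

/-! ## The discharge: a jointly measurable version of the solution family -/

/-- **Kunita / SZZ Lemma 3.2 for `SU(2)` in its fundamental representation on `(ℤ/L)³`: the named fact
`LatticeLangevinMeasurableFlow (fundamentalLatticeRep 2) 3 L β` HOLDS** — on every probability space with a flat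
Brownian motion there is a family of solutions of the Shen–Zhu–Zhu system from every start, adapted to the raw
natural filtration of the driver, jointly measurable in (start, `ω`) at every time.  (Measurable modification of the
strong solutions `solution_from_start` along measurable `4⁻ⁿ`-nets of starts, by `ae_tendsto_solutions`.)
[cite: Kunita1984, Ch. II §2 Thm 2.2 (LNM 1097, p. 188)] [cite: ShenZhuZhu2022, §3 Lemma 3.2 (global well-posedness, notation Q(t,x); p. 13)] -/
theorem latticeLangevinMeasurableFlow_su2 (L : ℕ) [NeZero L] (β : ℝ) :
    LatticeLangevinMeasurableFlow (fundamentalLatticeRep 2) 3 L β := by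
  intro _hscope Ω _ P _ W hW
  classical
  haveI := secondCountableTopology_su2
  haveI := borelSpace_config L
  haveI := polishSpace_config L
  haveI : Nonempty (GaugeConfig 3 L (Matrix.specialUnitaryGroup (Fin 2) ℂ)) := ⟨fun _ => 1⟩
  obtain ⟨u, ι, hι, hD⟩ := exists_measurable_nets L
  choose Ux hUx0 hUx using fun x : GaugeConfig 3 L (Matrix.specialUnitaryGroup (Fin 2) ℂ) =>
    solution_from_start hW β x
  refine ⟨fun x t ω => limUnder atTop (fun n => Ux (u (ι n x)) t ω), fun x => ⟨fun ω => ?_, ?_⟩, fun t => ?_⟩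
  · -- the start: `u (ι n x) → x`
    have hlim : Tendsto (fun n => Ux (u (ι n x)) 0 ω) atTop (𝓝 x) := by
      have hfun : (fun n => Ux (u (ι n x)) 0 ω) = fun n => u (ι n x) := funext fun n => hUx0 _ ω
      rw [hfun]
      exact tendsto_of_hsDist_tendsto_zero (squeeze_zero (fun n => hsDist_nonneg _ _) (fun n => (hD n x).le)
        (tendsto_pow_atTop_nhds_zero_of_lt_one (by norm_num) (by norm_num)))
    exact hlim.limUnder_eq
  · -- a solution: adapted and indistinguishable from the solution from `x`
    have hae := ae_tendsto_solutions hW β (x := x) (xs := fun n => u (ι n x)) (fun n => (hD n x).le) (hUx0 x) (hUx x)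
      (V := fun n => Ux (u (ι n x))) (fun n ω => hUx0 _ ω) (fun n => hUx _)
    refine isSolution_of_indist _ _ W (hUx x) (fun t => ?_) ?_
    · have hg : ∀ n, StronglyMeasurable[hW.natFiltration t] (fun ω => Ux (u (ι n x)) t ω) := fun n =>
        ((hUx (u (ι n x))).adapted t).stronglyMeasurable
      exact (@MeasureTheory.StronglyMeasurable.limUnder ℕ Ω _ (hW.natFiltration t) _ _ atTop _ _ _ _ hg).measurable
    · filter_upwards [hae] with ω hω
      exact fun t => (hω t).limUnder_eq
  · -- joint measurability in (start, ω)
    have hf : ∀ n, Measurable (fun p : GaugeConfig 3 L (Matrix.specialUnitaryGroup (Fin 2) ℂ) × Ω =>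
        Ux (u (ι n p.1)) t p.2) := fun n => by
      have h1 : Measurable (fun q : Ω × ℕ => Ux (u q.2) t q.1) :=
        measurable_from_prod_countable_left fun k =>
          ((hUx (u k)).adapted t).mono (hW.natFiltration.le t) le_rfl
      have h2 := h1.comp (measurable_snd.prodMk ((hι n).comp measurable_fst))
      exact h2
    exact (MeasureTheory.StronglyMeasurable.limUnder (l := atTop) fun n => (hf n).stronglyMeasurable).measurable

end Summit.QuantumFields.YangMills.Theorems.ColdStartUniversality

end
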